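import Mathlib.Analysis.Normed.Module.Multilinear.Curry
import Mathlib.Topology.Algebra.Module.Multilinear.Topology
import Mathlib.Analysis.Normed.Operator.Mul
import Mathlib.LinearAlgebra.Alternating.DomCoprod
import Mathlib.LinearAlgebra.BilinearMap
import Mathlib.GroupTheory.Perm.Fin
import Mathlib.Analysis.Calculus.DifferentialForm.Basic
import Mathlib.Analysis.Convex.Basic
import Mathlib.Geometry.Manifold.MFDeriv.Basic
import Mathlib.Geometry.Manifold.MFDeriv.SpecificFunctions
import Mathlib.Geometry.Manifold.ContMDiff.Basic
import Mathlib.Geometry.Manifold.IsManifold.Basic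
import Summits.Ventures.HodgeRepro2.HostAPI.Carriers.Geometry.Kaehler.AlternatingAux
import Summits.Ventures.HodgeRepro2.HostAPI.Carriers.Geometry.Kaehler.ManifoldForms
import Summits.Ventures.HodgeRepro2.HostAPI.Util.ForallBinderLint
open HostAPI.Carriers

noncomputable section

open scoped Manifold ContDiff Topology
open Set

namespace HostAPI.Carriers.ContinuousAlternatingMap
open HostAPI.Carriers _root_.ContinuousAlternatingMap

section Wedge

variable {𝕜 : Type*} [RCLike 𝕜] {V W : Type*} [NormedAddCommGroup V] [NormedSpace 𝕜 V]
  [NormedAddCommGroup W] [NormedSpace 𝕜 W]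
  {A : Type*} [NormedCommRing A] [NormedAlgebra 𝕜 A] {k l m : ℕ}

def wedge (α : V [⋀^Fin k]→L[𝕜] A) (β : V [⋀^Fin l]→L[𝕜] A) : V [⋀^Fin (k + l)]→L[𝕜] A :=
  letI φ : ContinuousMultilinearMap 𝕜 (fun _ : Fin k ↦ V)
      (ContinuousMultilinearMap 𝕜 (fun _ : Fin l ↦ V) A) :=
    ((ContinuousLinearMap.compContinuousMultilinearMapL 𝕜 (fun _ : Fin l ↦ V) A A).flip
        β.toContinuousMultilinearMap).compContinuousMultilinearMap
      ((ContinuousLinearMap.mul 𝕜 A).compContinuousMultilinearMap α.toContinuousMultilinearMap)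
  letI ψ : ContinuousMultilinearMap 𝕜 (fun _ : Fin (k + l) ↦ V) A :=
    ContinuousMultilinearMap.domDomCongr finSumFinEquiv φ.uncurrySum
  ((k.factorial * l.factorial : ℕ) : 𝕜)⁻¹ • ContinuousMultilinearMap.alternatization ψ

theorem wedge_apply (α : V [⋀^Fin k]→L[𝕜] A) (β : V [⋀^Fin l]→L[𝕜] A) (v : Fin (k + l) → V) :
    α.wedge β v = ((k.factorial * l.factorial : ℕ) : 𝕜)⁻¹ • ∑ σ : Equiv.Perm (Fin (k + l)),
      Equiv.Perm.sign σ •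
        (α (fun i ↦ v (σ (Fin.castAdd l i))) * β (fun j ↦ v (σ (Fin.natAdd k j)))) := by
  simp [wedge, ContinuousMultilinearMap.alternatization_apply_apply, Function.comp_def]

private theorem sum_perm_fin_one_add_one {N : Type*} [AddCommMonoid N]
    (f : Equiv.Perm (Fin (1 + 1)) → N) :
    ∑ σ : Equiv.Perm (Fin (1 + 1)), f σ = f 1 + f (Equiv.swap 0 1) := by
  rw [Finset.univ_perm_fin_succ, Finset.sum_map, Fintype.sum_prod_type]
  simp only [Fin.sum_univ_two, Finset.univ_unique, Finset.sum_singleton]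
  have h : (finSuccEquiv 1).symm.permCongr (Equiv.swap none ((finSuccEquiv 1) 1)) =
      Equiv.swap 0 1 := by
    decide
  simp [Equiv.Perm.decomposeFin, Equiv.Perm.decomposeOption, h]
  rfl

theorem wedge_apply_one_one (α β : V [⋀^Fin 1]→L[𝕜] A) (v : Fin (1 + 1) → V) :
    α.wedge β v = α ![v 0] * β ![v 1] - α ![v 1] * β ![v 0] := by
  rw [wedge_apply, sum_perm_fin_one_add_one]
  have h1 : (fun i : Fin 1 ↦ v (Fin.castAdd 1 i)) = ![v 0] := by funext i; fin_cases i; rfl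
  have h2 : (fun j : Fin 1 ↦ v j.succ) = ![v 1] := by funext i; fin_cases i; rfl
  have h3 : (fun i : Fin 1 ↦ v (Equiv.swap 0 1 (Fin.castAdd 1 i))) = ![v 1] := by
    funext i; fin_cases i; rfl
  have h4 : (fun j : Fin 1 ↦ v (Equiv.swap 0 1 j.succ)) = ![v 0] := by
    funext i; fin_cases i; rfl
  simp [Units.smul_def, sub_eq_add_neg, h1, h2, h3, h4]

theorem wedge_add_left (α₁ α₂ : V [⋀^Fin k]→L[𝕜] A) (β : V [⋀^Fin l]→L[𝕜] A) :
    (α₁ + α₂).wedge β = α₁.wedge β + α₂.wedge β := by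
  ext v
  simp only [wedge_apply, ContinuousAlternatingMap.add_apply, add_mul, smul_add, Finset.sum_add_distrib]

theorem wedge_add_right (α : V [⋀^Fin k]→L[𝕜] A) (β₁ β₂ : V [⋀^Fin l]→L[𝕜] A) :
    α.wedge (β₁ + β₂) = α.wedge β₁ + α.wedge β₂ := by
  ext v
  simp only [wedge_apply, ContinuousAlternatingMap.add_apply, mul_add, smul_add, Finset.sum_add_distrib]

theorem wedge_smul_left (c : 𝕜) (α : V [⋀^Fin k]→L[𝕜] A) (β : V [⋀^Fin l]→L[𝕜] A) :
    (c • α).wedge β = c • α.wedge β := by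
  ext v
  simp only [wedge_apply, ContinuousAlternatingMap.smul_apply, smul_mul_assoc, Finset.smul_sum]
  refine Finset.sum_congr rfl fun σ _ ↦ ?_
  rw [smul_comm (Equiv.Perm.sign σ) c, smul_comm _ c]

theorem wedge_smul_right (c : 𝕜) (α : V [⋀^Fin k]→L[𝕜] A) (β : V [⋀^Fin l]→L[𝕜] A) :
    α.wedge (c • β) = c • α.wedge β := by
  ext v
  simp only [wedge_apply, ContinuousAlternatingMap.smul_apply, mul_smul_comm, Finset.smul_sum]
  refine Finset.sum_congr rfl fun σ _ ↦ ?_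
  rw [smul_comm (Equiv.Perm.sign σ) c, smul_comm _ c]

@[simp]
theorem zero_wedge (β : V [⋀^Fin l]→L[𝕜] A) : (0 : V [⋀^Fin k]→L[𝕜] A).wedge β = 0 := by
  ext v
  simp [wedge_apply]

@[simp]
theorem wedge_zero (α : V [⋀^Fin k]→L[𝕜] A) : α.wedge (0 : V [⋀^Fin l]→L[𝕜] A) = 0 := by
  ext v
  simp [wedge_apply]

variable (𝕜 V A) in

def WedgeAssoc : Prop :=
  ∀ {k l m : ℕ} (α : V [⋀^Fin k]→L[𝕜] A) (β : V [⋀^Fin l]→L[𝕜] A) (γ : V [⋀^Fin m]→L[𝕜] A),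
    (α.wedge β).wedge γ =
      (α.wedge (β.wedge γ)).domDomCongr (finCongr (Nat.add_assoc k l m).symm)

variable (𝕜 V A) in

def WedgeComm : Prop :=
  ∀ {k l : ℕ} (α : V [⋀^Fin k]→L[𝕜] A) (β : V [⋀^Fin l]→L[𝕜] A),
    β.wedge α = ((-1 : 𝕜) ^ (k * l)) • (α.wedge β).domDomCongr (finCongr (Nat.add_comm k l))

theorem constOfIsEmpty_one_wedge (β : V [⋀^Fin l]→L[𝕜] A) :
    (constOfIsEmpty 𝕜 V (Fin 0) (1 : A)).wedge β =
      β.domDomCongr (finCongr (Nat.zero_add l).symm) := by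
  ext v
  rw [wedge_apply, domDomCongr_apply]
  have hterm : ∀ σ : Equiv.Perm (Fin (0 + l)),
      Equiv.Perm.sign σ • ((constOfIsEmpty 𝕜 V (Fin 0) (1 : A))
        (fun i ↦ v (σ (Fin.castAdd l i))) * β (fun j ↦ v (σ (Fin.natAdd 0 j)))) =
        β (v ∘ finCongr (Nat.zero_add l).symm) := by
    intro σ
    have h1 : (fun j ↦ v (σ (Fin.natAdd 0 j))) =
        (v ∘ finCongr (Nat.zero_add l).symm) ∘
          ((finCongr (Nat.zero_add l).symm).symm.permCongr σ) := by
      funext j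
      simp only [Function.comp_apply, Equiv.permCongr_apply, Equiv.symm_symm,
        Equiv.apply_symm_apply, Fin.natAdd_zero, finCongr_apply]
    rw [constOfIsEmpty_apply, one_mul, h1, ← coe_toAlternatingMap, AlternatingMap.map_perm,
      Equiv.Perm.sign_permCongr, smul_smul, Int.units_mul_self, one_smul]
  have hfac : Nat.factorial 0 * l.factorial = (0 + l).factorial := by
    rw [Nat.factorial_zero, one_mul, Nat.zero_add]
  rw [Finset.sum_congr rfl fun σ _ ↦ hterm σ, Finset.sum_const, Finset.card_univ,
    Fintype.card_perm, Fintype.card_fin, hfac, ← Nat.cast_smul_eq_nsmul 𝕜, smul_smul,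
    inv_mul_cancel₀ (Nat.cast_ne_zero.2 (Nat.factorial_ne_zero _)), one_smul]

theorem wedge_compContinuousLinearMap (α : V [⋀^Fin k]→L[𝕜] A) (β : V [⋀^Fin l]→L[𝕜] A)
    (g : W →L[𝕜] V) :
    (α.wedge β).compContinuousLinearMap g =
      (α.compContinuousLinearMap g).wedge (β.compContinuousLinearMap g) := by
  ext v
  simp only [compContinuousLinearMap_apply, wedge_apply, Function.comp_def]

variable (𝕜 V A) in

def ToAlternatingMapWedge : Prop :=
  ∀ {k l : ℕ} (α : V [⋀^Fin k]→L[𝕜] A) (β : V [⋀^Fin l]→L[𝕜] A),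
    (α.wedge β).toAlternatingMap =
      ((LinearMap.mul' 𝕜 A).compAlternatingMap
        (α.toAlternatingMap.domCoprod β.toAlternatingMap)).domDomCongr finSumFinEquiv

end Wedge

end HostAPI.Carriers.ContinuousAlternatingMap

namespace HostAPI.Carriers.NumberTheory.Transcendental

variable {E : Type*} [NormedAddCommGroup E] [NormedSpace ℝ E]
  {H : Type*} [TopologicalSpace H] {I : ModelWithCorners ℝ E H}
  {M : Type*} [TopologicalSpace M] [ChartedSpace H M]
  {E' : Type*} [NormedAddCommGroup E'] [NormedSpace ℝ E']
  {H' : Type*} [TopologicalSpace H'] {I' : ModelWithCorners ℝ E' H'}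
  {N : Type*} [TopologicalSpace N] [ChartedSpace H' N]
  {E'' : Type*} [NormedAddCommGroup E''] [NormedSpace ℝ E'']
  {H'' : Type*} [TopologicalSpace H''] {I'' : ModelWithCorners ℝ E'' H''}
  {P : Type*} [TopologicalSpace P] [ChartedSpace H'' P]
  {F : Type*} [NormedAddCommGroup F] [NormedSpace ℝ F]
  {A : Type*} [NormedCommRing A] [NormedAlgebra ℝ A]
  {k l m k' : ℕ}

section MForm
open HostAPI.Carriers.Geometry.Kaehler (MForm)
open HostAPI.Carriers.Geometry.Kaehler.MForm

def _root_.HostAPI.Carriers.Geometry.Kaehler.MForm.wedge (α : MForm I M A k) (β : MForm I M A l) : MForm I M A (k + l) := fun x ↦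
  letI a : E [⋀^Fin k]→L[ℝ] A := α x
  letI b : E [⋀^Fin l]→L[ℝ] A := β x
  letI c : E [⋀^Fin (k + l)]→L[ℝ] A := a.wedge b
  c

theorem _root_.HostAPI.Carriers.Geometry.Kaehler.MForm.wedge_apply (α : MForm I M A k) (β : MForm I M A l) (x : M) :
    α.wedge β x =
      (letI a : E [⋀^Fin k]→L[ℝ] A := α x
      letI b : E [⋀^Fin l]→L[ℝ] A := β x
      (a.wedge b : E [⋀^Fin (k + l)]→L[ℝ] A)) :=
  rfl

theorem _root_.HostAPI.Carriers.Geometry.Kaehler.MForm.wedge_add_left (α₁ α₂ : MForm I M A k) (β : MForm I M A l) :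
    (α₁ + α₂).wedge β = α₁.wedge β + α₂.wedge β :=
  funext fun x ↦ ContinuousAlternatingMap.wedge_add_left (V := E) (α₁ x) (α₂ x) (β x)

theorem _root_.HostAPI.Carriers.Geometry.Kaehler.MForm.wedge_add_right (α : MForm I M A k) (β₁ β₂ : MForm I M A l) :
    α.wedge (β₁ + β₂) = α.wedge β₁ + α.wedge β₂ :=
  funext fun x ↦ ContinuousAlternatingMap.wedge_add_right (V := E) (α x) (β₁ x) (β₂ x)

theorem _root_.HostAPI.Carriers.Geometry.Kaehler.MForm.wedge_smul_left (c : ℝ) (α : MForm I M A k) (β : MForm I M A l) :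
    (c • α).wedge β = c • α.wedge β :=
  funext fun x ↦ ContinuousAlternatingMap.wedge_smul_left (V := E) c (α x) (β x)

theorem _root_.HostAPI.Carriers.Geometry.Kaehler.MForm.wedge_smul_right (c : ℝ) (α : MForm I M A k) (β : MForm I M A l) :
    α.wedge (c • β) = c • α.wedge β :=
  funext fun x ↦ ContinuousAlternatingMap.wedge_smul_right (V := E) c (α x) (β x)

@[simp]
theorem _root_.HostAPI.Carriers.Geometry.Kaehler.MForm.zero_wedge (β : MForm I M A l) : (0 : MForm I M A k).wedge β = 0 :=
  funext fun x ↦ ContinuousAlternatingMap.zero_wedge (V := E) (β x)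

@[simp]
theorem _root_.HostAPI.Carriers.Geometry.Kaehler.MForm.wedge_zero (α : MForm I M A k) : α.wedge (0 : MForm I M A l) = 0 :=
  funext fun x ↦ ContinuousAlternatingMap.wedge_zero (V := E) (α x)

def _root_.HostAPI.Carriers.Geometry.Kaehler.MForm.castDeg (h : k = k') (α : MForm I M F k) : MForm I M F k' := fun x ↦
  letI a : E [⋀^Fin k]→L[ℝ] F := α x
  letI b : E [⋀^Fin k']→L[ℝ] F := a.domDomCongr (finCongr h)
  b

@[simp]
theorem _root_.HostAPI.Carriers.Geometry.Kaehler.MForm.castDeg_apply (h : k = k') (α : MForm I M F k) (x : M) (v : Fin k' → TangentSpace I x) :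
    α.castDeg h x v = α x (fun i ↦ v (Fin.cast h i)) :=
  rfl

@[simp]
theorem _root_.HostAPI.Carriers.Geometry.Kaehler.MForm.castDeg_rfl (α : MForm I M F k) : α.castDeg rfl = α :=
  rfl

theorem _root_.HostAPI.Carriers.Geometry.Kaehler.MForm.castDeg_castDeg {k'' : ℕ} (h : k = k') (h' : k' = k'') (α : MForm I M F k) :
    (α.castDeg h).castDeg h' = α.castDeg (h.trans h') :=
  rfl

@[simp]
theorem _root_.HostAPI.Carriers.Geometry.Kaehler.MForm.castDeg_add (h : k = k') (α β : MForm I M F k) :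
    (α + β).castDeg h = α.castDeg h + β.castDeg h :=
  rfl

@[simp]
theorem _root_.HostAPI.Carriers.Geometry.Kaehler.MForm.castDeg_smul (h : k = k') (c : ℝ) (α : MForm I M F k) :
    (c • α).castDeg h = c • α.castDeg h :=
  rfl

@[simp]
theorem _root_.HostAPI.Carriers.Geometry.Kaehler.MForm.castDeg_zero (h : k = k') : (0 : MForm I M F k).castDeg h = 0 :=
  rfl

variable (I) in

def _root_.HostAPI.Carriers.Geometry.Kaehler.MForm.pullback (f : M → N) (β : MForm I' N F k) : MForm I M F k := fun x ↦
  (β (f x)).compContinuousLinearMap (mfderiv I I' f x)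

@[simp]
theorem _root_.HostAPI.Carriers.Geometry.Kaehler.MForm.pullback_apply (f : M → N) (β : MForm I' N F k) (x : M) (v : Fin k → TangentSpace I x) :
    β.pullback I f x v = β (f x) (fun i ↦ mfderiv I I' f x (v i)) :=
  rfl

@[simp]
theorem _root_.HostAPI.Carriers.Geometry.Kaehler.MForm.pullback_add (f : M → N) (β₁ β₂ : MForm I' N F k) :
    (β₁ + β₂).pullback I f = β₁.pullback I f + β₂.pullback I f :=
  rfl

@[simp]
theorem _root_.HostAPI.Carriers.Geometry.Kaehler.MForm.pullback_smul (f : M → N) (c : ℝ) (β : MForm I' N F k) :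
    (c • β).pullback I f = c • β.pullback I f :=
  rfl

@[simp]
theorem _root_.HostAPI.Carriers.Geometry.Kaehler.MForm.pullback_zero (f : M → N) : (0 : MForm I' N F k).pullback I f = 0 :=
  rfl

variable (I) in

def _root_.HostAPI.Carriers.Geometry.Kaehler.MForm.pullbackₗ (f : M → N) (k : ℕ) : MForm I' N F k →ₗ[ℝ] MForm I M F k where
  toFun β := β.pullback I f
  map_add' _ _ := rfl
  map_smul' _ _ := rfl

@[simp]
theorem _root_.HostAPI.Carriers.Geometry.Kaehler.MForm.pullbackₗ_apply (f : M → N) (β : MForm I' N F k) : pullbackₗ I f k β = β.pullback I f :=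
  rfl

theorem _root_.HostAPI.Carriers.Geometry.Kaehler.MForm.pullback_castDeg (f : M → N) (h : k = k') (β : MForm I' N F k) :
    (β.castDeg h).pullback I f = (β.pullback I f).castDeg h :=
  rfl

@[simp]
theorem _root_.HostAPI.Carriers.Geometry.Kaehler.MForm.pullback_id (α : MForm I M F k) : α.pullback I (id : M → M) = α := by
  funext x
  ext v
  simp only [pullback_apply, mfderiv_id]
  rfl

theorem _root_.HostAPI.Carriers.Geometry.Kaehler.MForm.pullback_comp {g : N → P} {f : M → N} (hg : MDifferentiable I' I'' g)
    (hf : MDifferentiable I I' f) (γ : MForm I'' P F k) :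
    γ.pullback I (g ∘ f) = (γ.pullback I' g).pullback I f := by
  funext x
  ext v
  simp only [pullback_apply, Function.comp_apply, mfderiv_comp x (hg (f x)) (hf x)]
  rfl

theorem _root_.HostAPI.Carriers.Geometry.Kaehler.MForm.pullback_wedge (f : M → N) (α : MForm I' N A k) (β : MForm I' N A l) :
    (α.wedge β).pullback I f = (α.pullback I f).wedge (β.pullback I f) :=
  funext fun x ↦
    ContinuousAlternatingMap.wedge_compContinuousLinearMap (V := E') (W := E) (α (f x)) (β (f x))
      (mfderiv I I' f x)

end MForm

variable (I M A) in

def IsSmoothFormWedge : Prop :=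
  ∀ {k l : ℕ} {α : HostAPI.Carriers.Geometry.Kaehler.MForm I M A k} {β : HostAPI.Carriers.Geometry.Kaehler.MForm I M A l},
    HostAPI.Carriers.Geometry.Kaehler.IsSmoothForm α → HostAPI.Carriers.Geometry.Kaehler.IsSmoothForm β → HostAPI.Carriers.Geometry.Kaehler.IsSmoothForm (α.wedge β)

theorem isSmoothForm_castDeg (h : k = k') {α : HostAPI.Carriers.Geometry.Kaehler.MForm I M F k} (hα : HostAPI.Carriers.Geometry.Kaehler.IsSmoothForm α) :
    HostAPI.Carriers.Geometry.Kaehler.IsSmoothForm (α.castDeg h) := by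
  subst h
  exact hα

theorem mextDeriv_castDeg (h : k = k') (α : HostAPI.Carriers.Geometry.Kaehler.MForm I M F k) :
    HostAPI.Carriers.Geometry.Kaehler.mextDeriv (α.castDeg h) = (HostAPI.Carriers.Geometry.Kaehler.mextDeriv α).castDeg (congrArg (· + 1) h) := by
  subst h
  rfl

theorem castDeg_mem_closedSmoothForms (h : k = k') {α : HostAPI.Carriers.Geometry.Kaehler.MForm I M F k}
    (hα : α ∈ HostAPI.Carriers.Geometry.Kaehler.closedSmoothForms I M F k) : α.castDeg h ∈ HostAPI.Carriers.Geometry.Kaehler.closedSmoothForms I M F k' := by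
  subst h
  exact hα

theorem castDeg_mem_exactSmoothForms (h : k = k') {α : HostAPI.Carriers.Geometry.Kaehler.MForm I M F k}
    (hα : α ∈ HostAPI.Carriers.Geometry.Kaehler.exactSmoothForms I M F k) : α.castDeg h ∈ HostAPI.Carriers.Geometry.Kaehler.exactSmoothForms I M F k' := by
  subst h
  exact hα

section Leibniz

variable (I M A) in

def MextDerivWedge : Prop :=
  ∀ {k l : ℕ} {α : HostAPI.Carriers.Geometry.Kaehler.MForm I M A k} {β : HostAPI.Carriers.Geometry.Kaehler.MForm I M A l}, HostAPI.Carriers.Geometry.Kaehler.IsSmoothForm α → HostAPI.Carriers.Geometry.Kaehler.IsSmoothForm β →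
    HostAPI.Carriers.Geometry.Kaehler.mextDeriv (α.wedge β) =
      ((HostAPI.Carriers.Geometry.Kaehler.mextDeriv α).wedge β).castDeg (Nat.add_right_comm k 1 l) +
        ((-1 : ℝ) ^ k) • α.wedge (HostAPI.Carriers.Geometry.Kaehler.mextDeriv β)

variable (I M A) in

class WedgeFacts : Prop where

  isSmoothForm_wedge : IsSmoothFormWedge I M A

  mextDeriv_wedge : MextDerivWedge I M A

  wedge_assoc : ContinuousAlternatingMap.WedgeAssoc ℝ E A

  wedge_comm : ContinuousAlternatingMap.WedgeComm ℝ E A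

theorem isSmoothForm_wedge [WedgeFacts I M A] {α : HostAPI.Carriers.Geometry.Kaehler.MForm I M A k} {β : HostAPI.Carriers.Geometry.Kaehler.MForm I M A l}
    (hα : HostAPI.Carriers.Geometry.Kaehler.IsSmoothForm α) (hβ : HostAPI.Carriers.Geometry.Kaehler.IsSmoothForm β) : HostAPI.Carriers.Geometry.Kaehler.IsSmoothForm (α.wedge β) :=
  WedgeFacts.isSmoothForm_wedge hα hβ

theorem mextDeriv_wedge [WedgeFacts I M A] {α : HostAPI.Carriers.Geometry.Kaehler.MForm I M A k} {β : HostAPI.Carriers.Geometry.Kaehler.MForm I M A l}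
    (hα : HostAPI.Carriers.Geometry.Kaehler.IsSmoothForm α) (hβ : HostAPI.Carriers.Geometry.Kaehler.IsSmoothForm β) :
    HostAPI.Carriers.Geometry.Kaehler.mextDeriv (α.wedge β) =
      ((HostAPI.Carriers.Geometry.Kaehler.mextDeriv α).wedge β).castDeg (Nat.add_right_comm k 1 l) +
        ((-1 : ℝ) ^ k) • α.wedge (HostAPI.Carriers.Geometry.Kaehler.mextDeriv β) :=
  WedgeFacts.mextDeriv_wedge hα hβ

theorem _root_.HostAPI.Carriers.Geometry.Kaehler.MForm.wedge_assoc [WedgeFacts I M A] (α : HostAPI.Carriers.Geometry.Kaehler.MForm I M A k) (β : HostAPI.Carriers.Geometry.Kaehler.MForm I M A l)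
    (γ : HostAPI.Carriers.Geometry.Kaehler.MForm I M A m) :
    (α.wedge β).wedge γ = (α.wedge (β.wedge γ)).castDeg (Nat.add_assoc k l m).symm :=
  funext fun x ↦ WedgeFacts.wedge_assoc (I := I) (M := M) (α x) (β x) (γ x)

theorem _root_.HostAPI.Carriers.Geometry.Kaehler.MForm.wedge_comm [WedgeFacts I M A] (α : HostAPI.Carriers.Geometry.Kaehler.MForm I M A k) (β : HostAPI.Carriers.Geometry.Kaehler.MForm I M A l) :
    β.wedge α = ((-1 : ℝ) ^ (k * l)) • (α.wedge β).castDeg (Nat.add_comm k l) :=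
  funext fun x ↦ WedgeFacts.wedge_comm (I := I) (M := M) (α x) (β x)

theorem _root_.HostAPI.Carriers.Geometry.Kaehler.IsClosedForm.wedge [WedgeFacts I M A] {α : HostAPI.Carriers.Geometry.Kaehler.MForm I M A k} {β : HostAPI.Carriers.Geometry.Kaehler.MForm I M A l}
    (hα : HostAPI.Carriers.Geometry.Kaehler.IsClosedForm α) (hβ : HostAPI.Carriers.Geometry.Kaehler.IsClosedForm β) (hαs : HostAPI.Carriers.Geometry.Kaehler.IsSmoothForm α) (hβs : HostAPI.Carriers.Geometry.Kaehler.IsSmoothForm β) :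
    HostAPI.Carriers.Geometry.Kaehler.IsClosedForm (α.wedge β) := by
  rw [HostAPI.Carriers.Geometry.Kaehler.IsClosedForm] at hα hβ ⊢
  rw [mextDeriv_wedge hαs hβs, hα, hβ, HostAPI.Carriers.Geometry.Kaehler.MForm.zero_wedge, HostAPI.Carriers.Geometry.Kaehler.MForm.wedge_zero, HostAPI.Carriers.Geometry.Kaehler.MForm.castDeg_zero,
    smul_zero, add_zero]

theorem wedge_mem_closedSmoothForms [WedgeFacts I M A] {α : HostAPI.Carriers.Geometry.Kaehler.MForm I M A k} {β : HostAPI.Carriers.Geometry.Kaehler.MForm I M A l}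
    (hα : α ∈ HostAPI.Carriers.Geometry.Kaehler.closedSmoothForms I M A k) (hβ : β ∈ HostAPI.Carriers.Geometry.Kaehler.closedSmoothForms I M A l) :
    α.wedge β ∈ HostAPI.Carriers.Geometry.Kaehler.closedSmoothForms I M A (k + l) :=
  ⟨isSmoothForm_wedge hα.1 hβ.1, hα.2.wedge hβ.2 hα.1 hβ.1⟩

theorem wedge_mem_exactSmoothForms_of_left [WedgeFacts I M A] {α : HostAPI.Carriers.Geometry.Kaehler.MForm I M A k}
    {β : HostAPI.Carriers.Geometry.Kaehler.MForm I M A l} (hα : α ∈ HostAPI.Carriers.Geometry.Kaehler.exactSmoothForms I M A k)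
    (hβ : β ∈ HostAPI.Carriers.Geometry.Kaehler.closedSmoothForms I M A l) : α.wedge β ∈ HostAPI.Carriers.Geometry.Kaehler.exactSmoothForms I M A (k + l) := by
  cases k with
  | zero =>
    simp only [HostAPI.Carriers.Geometry.Kaehler.exactSmoothForms, Submodule.mem_bot] at hα
    rw [hα, HostAPI.Carriers.Geometry.Kaehler.MForm.zero_wedge]
    exact zero_mem _
  | succ k =>
    have hkl : k + l + 1 = k + 1 + l := Nat.add_right_comm k l 1
    suffices h : (α.wedge β).castDeg hkl.symm ∈ HostAPI.Carriers.Geometry.Kaehler.exactSmoothForms I M A (k + l + 1) from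
      castDeg_mem_exactSmoothForms hkl h
    simp only [HostAPI.Carriers.Geometry.Kaehler.exactSmoothForms] at hα ⊢
    refine Submodule.span_induction ?_ ?_ ?_ ?_ hα
    · rintro _ ⟨γ, hγ, rfl⟩
      have hγ : HostAPI.Carriers.Geometry.Kaehler.IsSmoothForm γ := hγ
      have hL := mextDeriv_wedge hγ hβ.1
      rw [show HostAPI.Carriers.Geometry.Kaehler.mextDeriv β = 0 from hβ.2, HostAPI.Carriers.Geometry.Kaehler.MForm.wedge_zero, smul_zero, add_zero] at hL
      rw [← hL]
      exact Submodule.subset_span ⟨γ.wedge β, isSmoothForm_wedge hγ hβ.1, rfl⟩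
    · rw [HostAPI.Carriers.Geometry.Kaehler.MForm.zero_wedge, HostAPI.Carriers.Geometry.Kaehler.MForm.castDeg_zero]
      exact zero_mem _
    · intro a b _ _ ha hb
      rw [HostAPI.Carriers.Geometry.Kaehler.MForm.wedge_add_left, HostAPI.Carriers.Geometry.Kaehler.MForm.castDeg_add]
      exact add_mem ha hb
    · intro c a _ ha
      rw [HostAPI.Carriers.Geometry.Kaehler.MForm.wedge_smul_left, HostAPI.Carriers.Geometry.Kaehler.MForm.castDeg_smul]
      exact Submodule.smul_mem _ c ha

theorem wedge_mem_exactSmoothForms_of_right [WedgeFacts I M A] {α : HostAPI.Carriers.Geometry.Kaehler.MForm I M A k}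
    {β : HostAPI.Carriers.Geometry.Kaehler.MForm I M A l} (hα : α ∈ HostAPI.Carriers.Geometry.Kaehler.closedSmoothForms I M A k)
    (hβ : β ∈ HostAPI.Carriers.Geometry.Kaehler.exactSmoothForms I M A l) : α.wedge β ∈ HostAPI.Carriers.Geometry.Kaehler.exactSmoothForms I M A (k + l) := by
  cases l with
  | zero =>
    simp only [HostAPI.Carriers.Geometry.Kaehler.exactSmoothForms, Submodule.mem_bot] at hβ
    rw [hβ, HostAPI.Carriers.Geometry.Kaehler.MForm.wedge_zero]
    exact zero_mem _
  | succ l =>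
    show α.wedge β ∈ HostAPI.Carriers.Geometry.Kaehler.exactSmoothForms I M A (k + l + 1)
    simp only [HostAPI.Carriers.Geometry.Kaehler.exactSmoothForms] at hβ ⊢
    refine Submodule.span_induction ?_ ?_ ?_ ?_ hβ
    · rintro _ ⟨γ, hγ, rfl⟩
      have hγ : HostAPI.Carriers.Geometry.Kaehler.IsSmoothForm γ := hγ
      have hL := mextDeriv_wedge hα.1 hγ
      rw [show HostAPI.Carriers.Geometry.Kaehler.mextDeriv α = 0 from hα.2, HostAPI.Carriers.Geometry.Kaehler.MForm.zero_wedge, HostAPI.Carriers.Geometry.Kaehler.MForm.castDeg_zero, zero_add] at hL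
      have h2 : α.wedge (HostAPI.Carriers.Geometry.Kaehler.mextDeriv γ) = ((-1 : ℝ) ^ k) • HostAPI.Carriers.Geometry.Kaehler.mextDeriv (α.wedge γ) := by
        rw [hL, smul_smul, ← pow_add, ← two_mul, pow_mul, neg_one_sq, one_pow, one_smul]
      rw [h2]
      exact Submodule.smul_mem _ _
        (Submodule.subset_span ⟨α.wedge γ, isSmoothForm_wedge hα.1 hγ, rfl⟩)
    · rw [HostAPI.Carriers.Geometry.Kaehler.MForm.wedge_zero]
      exact zero_mem _
    · intro a b _ _ ha hb
      rw [HostAPI.Carriers.Geometry.Kaehler.MForm.wedge_add_right]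
      exact add_mem ha hb
    · intro c a _ ha
      rw [HostAPI.Carriers.Geometry.Kaehler.MForm.wedge_smul_right]
      exact Submodule.smul_mem _ c ha

end Leibniz

section Pullback

variable (I M I' N F) in

def IsSmoothFormPullback [IsManifold I ∞ M] [IsManifold I' ∞ N] : Prop :=
  ∀ {k : ℕ} {f : M → N}, ContMDiff I I' ∞ f → ∀ {β : HostAPI.Carriers.Geometry.Kaehler.MForm I' N F k},
    HostAPI.Carriers.Geometry.Kaehler.IsSmoothForm β → HostAPI.Carriers.Geometry.Kaehler.IsSmoothForm (β.pullback I f)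

variable (I M I' N F) in

def MextDerivPullback [IsManifold I ∞ M] [IsManifold I' ∞ N] : Prop :=
  ∀ {k : ℕ} {f : M → N}, ContMDiff I I' ∞ f → ∀ {β : HostAPI.Carriers.Geometry.Kaehler.MForm I' N F k},
    HostAPI.Carriers.Geometry.Kaehler.IsSmoothForm β → HostAPI.Carriers.Geometry.Kaehler.mextDeriv (β.pullback I f) = (HostAPI.Carriers.Geometry.Kaehler.mextDeriv β).pullback I f

variable (I M I' N F) in

class PullbackFacts [IsManifold I ∞ M] [IsManifold I' ∞ N] : Prop where

  isSmoothForm_pullback : IsSmoothFormPullback I M I' N F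

  mextDeriv_pullback : MextDerivPullback I M I' N F

variable [IsManifold I ∞ M] [IsManifold I' ∞ N]

theorem isSmoothForm_pullback [PullbackFacts I M I' N F] {f : M → N} (hf : ContMDiff I I' ∞ f)
    {β : HostAPI.Carriers.Geometry.Kaehler.MForm I' N F k} (hβ : HostAPI.Carriers.Geometry.Kaehler.IsSmoothForm β) : HostAPI.Carriers.Geometry.Kaehler.IsSmoothForm (β.pullback I f) :=
  PullbackFacts.isSmoothForm_pullback hf hβ

theorem mextDeriv_pullback [PullbackFacts I M I' N F] {f : M → N} (hf : ContMDiff I I' ∞ f)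
    {β : HostAPI.Carriers.Geometry.Kaehler.MForm I' N F k} (hβ : HostAPI.Carriers.Geometry.Kaehler.IsSmoothForm β) :
    HostAPI.Carriers.Geometry.Kaehler.mextDeriv (β.pullback I f) = (HostAPI.Carriers.Geometry.Kaehler.mextDeriv β).pullback I f :=
  PullbackFacts.mextDeriv_pullback hf hβ

theorem pullback_mem_closedSmoothForms [PullbackFacts I M I' N F] {f : M → N}
    (hf : ContMDiff I I' ∞ f) {β : HostAPI.Carriers.Geometry.Kaehler.MForm I' N F k} (hβ : β ∈ HostAPI.Carriers.Geometry.Kaehler.closedSmoothForms I' N F k) :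
    β.pullback I f ∈ HostAPI.Carriers.Geometry.Kaehler.closedSmoothForms I M F k := by
  refine ⟨isSmoothForm_pullback hf hβ.1, ?_⟩
  have h : HostAPI.Carriers.Geometry.Kaehler.mextDeriv β = 0 := hβ.2
  rw [HostAPI.Carriers.Geometry.Kaehler.IsClosedForm, mextDeriv_pullback hf hβ.1, h, HostAPI.Carriers.Geometry.Kaehler.MForm.pullback_zero]

theorem pullback_mem_exactSmoothForms [PullbackFacts I M I' N F] {f : M → N}
    (hf : ContMDiff I I' ∞ f) {β : HostAPI.Carriers.Geometry.Kaehler.MForm I' N F k} (hβ : β ∈ HostAPI.Carriers.Geometry.Kaehler.exactSmoothForms I' N F k) :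
    β.pullback I f ∈ HostAPI.Carriers.Geometry.Kaehler.exactSmoothForms I M F k := by
  cases k with
  | zero =>
    simp only [HostAPI.Carriers.Geometry.Kaehler.exactSmoothForms, Submodule.mem_bot] at hβ ⊢
    rw [hβ, HostAPI.Carriers.Geometry.Kaehler.MForm.pullback_zero]
  | succ k =>
    simp only [HostAPI.Carriers.Geometry.Kaehler.exactSmoothForms] at hβ ⊢
    refine Submodule.span_induction ?_ ?_ ?_ ?_ hβ
    · rintro _ ⟨γ, hγ, rfl⟩
      have hγ : HostAPI.Carriers.Geometry.Kaehler.IsSmoothForm γ := hγ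
      rw [← mextDeriv_pullback hf hγ]
      exact Submodule.subset_span ⟨γ.pullback I f, isSmoothForm_pullback hf hγ, rfl⟩
    · rw [HostAPI.Carriers.Geometry.Kaehler.MForm.pullback_zero]
      exact zero_mem _
    · intro a b _ _ ha hb
      rw [HostAPI.Carriers.Geometry.Kaehler.MForm.pullback_add]
      exact add_mem ha hb
    · intro c a _ ha
      rw [HostAPI.Carriers.Geometry.Kaehler.MForm.pullback_smul]
      exact Submodule.smul_mem _ c ha

end Pullback

theorem inChart_eq_pullback [I.Boundaryless] (α : HostAPI.Carriers.Geometry.Kaehler.MForm I M F k) (x₀ : M) :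
    α.inChart x₀ = α.pullback 𝓘(ℝ, E) (extChartAt I x₀).symm := by
  funext y
  simp only [HostAPI.Carriers.Geometry.Kaehler.MForm.inChart, HostAPI.Carriers.Geometry.Kaehler.MForm.pullback, ← mfderivWithin_univ, ModelWithCorners.range_eq_univ]
  rfl

variable (E F) in

def ExactSmoothFormsEqClosedSmoothFormsOfConvex [CompleteSpace E] [CompleteSpace F] : Prop :=
  ∀ (U : TopologicalSpace.Opens E), Convex ℝ (U : Set E) → ∀ k : ℕ,
    HostAPI.Carriers.Geometry.Kaehler.exactSmoothForms 𝓘(ℝ, E) U F (k + 1) = HostAPI.Carriers.Geometry.Kaehler.closedSmoothForms 𝓘(ℝ, E) U F (k + 1)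

section deRhamCohomology
open HostAPI.Carriers.Geometry.Kaehler (deRhamCohomology)
open HostAPI.Carriers.Geometry.Kaehler.deRhamCohomology

section Map

variable [IsManifold I ∞ M] [IsManifold I' ∞ N] [IsManifold I'' ∞ P]

def _root_.HostAPI.Carriers.Geometry.Kaehler.deRhamCohomology.map [PullbackFacts I M I' N F] {f : M → N} (hf : ContMDiff I I' ∞ f) (k : ℕ) :
    deRhamCohomology I' N F k →ₗ[ℝ] deRhamCohomology I M F k :=
  Submodule.mapQ _ _
    ((HostAPI.Carriers.Geometry.Kaehler.MForm.pullbackₗ I f k).restrict fun _ hβ ↦ pullback_mem_closedSmoothForms hf hβ)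
    fun _ hβ ↦ pullback_mem_exactSmoothForms hf hβ

theorem _root_.HostAPI.Carriers.Geometry.Kaehler.deRhamCohomology.map_mk [PullbackFacts I M I' N F] {f : M → N} (hf : ContMDiff I I' ∞ f)
    (β : HostAPI.Carriers.Geometry.Kaehler.closedSmoothForms I' N F k) :
    map hf k (mk β) =
      mk ⟨(β : HostAPI.Carriers.Geometry.Kaehler.MForm I' N F k).pullback I f, pullback_mem_closedSmoothForms hf β.2⟩ :=
  rfl

theorem _root_.HostAPI.Carriers.Geometry.Kaehler.deRhamCohomology.map_id [PullbackFacts I M I M F] (k : ℕ) :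
    map (contMDiff_id : ContMDiff I I ∞ (id : M → M)) k =
      LinearMap.id (M := deRhamCohomology I M F k) := by
  refine Submodule.linearMap_qext _ (LinearMap.ext fun β ↦ ?_)
  change map contMDiff_id k (mk β) = mk β
  rw [map_mk]
  congr 1
  exact Subtype.ext (HostAPI.Carriers.Geometry.Kaehler.MForm.pullback_id _)

theorem _root_.HostAPI.Carriers.Geometry.Kaehler.deRhamCohomology.map_comp [PullbackFacts I M I' N F] [PullbackFacts I' N I'' P F] [PullbackFacts I M I'' P F]
    {g : N → P} {f : M → N} (hg : ContMDiff I' I'' ∞ g) (hf : ContMDiff I I' ∞ f) (k : ℕ) :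
    (map (hg.comp hf) k : deRhamCohomology I'' P F k →ₗ[ℝ] deRhamCohomology I M F k) =
      map hf k ∘ₗ map hg k := by
  refine Submodule.linearMap_qext _ (LinearMap.ext fun γ ↦ ?_)
  change map (hg.comp hf) k (mk γ) = map hf k (map hg k (mk γ))
  rw [map_mk, map_mk, map_mk]
  congr 1
  exact Subtype.ext (HostAPI.Carriers.Geometry.Kaehler.MForm.pullback_comp (hg.mdifferentiable (by simp))
    (hf.mdifferentiable (by simp)) _)

end Map

section Cup

variable [WedgeFacts I M A]

def _root_.HostAPI.Carriers.Geometry.Kaehler.deRhamCohomology.closedWedge (h : k + l = m) :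
    HostAPI.Carriers.Geometry.Kaehler.closedSmoothForms I M A k →ₗ[ℝ] HostAPI.Carriers.Geometry.Kaehler.closedSmoothForms I M A l →ₗ[ℝ] HostAPI.Carriers.Geometry.Kaehler.closedSmoothForms I M A m :=
  LinearMap.mk₂ ℝ
    (fun α β ↦ ⟨((α : HostAPI.Carriers.Geometry.Kaehler.MForm I M A k).wedge (β : HostAPI.Carriers.Geometry.Kaehler.MForm I M A l)).castDeg h,
      castDeg_mem_closedSmoothForms h (wedge_mem_closedSmoothForms α.2 β.2)⟩)
    (fun _ _ _ ↦ Subtype.ext <| by simp [HostAPI.Carriers.Geometry.Kaehler.MForm.wedge_add_left])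
    (fun _ _ _ ↦ Subtype.ext <| by simp [HostAPI.Carriers.Geometry.Kaehler.MForm.wedge_smul_left])
    (fun _ _ _ ↦ Subtype.ext <| by simp [HostAPI.Carriers.Geometry.Kaehler.MForm.wedge_add_right])
    (fun _ _ _ ↦ Subtype.ext <| by simp [HostAPI.Carriers.Geometry.Kaehler.MForm.wedge_smul_right])

@[simp]
theorem _root_.HostAPI.Carriers.Geometry.Kaehler.deRhamCohomology.coe_closedWedge (h : k + l = m) (α : HostAPI.Carriers.Geometry.Kaehler.closedSmoothForms I M A k)
    (β : HostAPI.Carriers.Geometry.Kaehler.closedSmoothForms I M A l) :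
    (closedWedge h α β : HostAPI.Carriers.Geometry.Kaehler.MForm I M A m) =
      ((α : HostAPI.Carriers.Geometry.Kaehler.MForm I M A k).wedge (β : HostAPI.Carriers.Geometry.Kaehler.MForm I M A l)).castDeg h :=
  rfl

def _root_.HostAPI.Carriers.Geometry.Kaehler.deRhamCohomology.cup (h : k + l = m) :
    deRhamCohomology I M A k →ₗ[ℝ] deRhamCohomology I M A l →ₗ[ℝ] deRhamCohomology I M A m :=
  letI B : HostAPI.Carriers.Geometry.Kaehler.closedSmoothForms I M A k →ₗ[ℝ] HostAPI.Carriers.Geometry.Kaehler.closedSmoothForms I M A l →ₗ[ℝ]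
      deRhamCohomology I M A m :=
    (closedWedge h).compr₂ mk
  letI B₁ : deRhamCohomology I M A l →ₗ[ℝ] HostAPI.Carriers.Geometry.Kaehler.closedSmoothForms I M A k →ₗ[ℝ]
      deRhamCohomology I M A m :=
    Submodule.liftQ _ B.flip fun β hβ ↦ by
      rw [LinearMap.mem_ker]
      refine LinearMap.ext fun α ↦ ?_
      exact (Submodule.Quotient.mk_eq_zero _).2
        (castDeg_mem_exactSmoothForms h (wedge_mem_exactSmoothForms_of_right α.2 hβ))
  Submodule.liftQ _ B₁.flip fun α hα ↦ by
    rw [LinearMap.mem_ker]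
    refine Submodule.linearMap_qext _ (LinearMap.ext fun β ↦ ?_)
    exact (Submodule.Quotient.mk_eq_zero _).2
      (castDeg_mem_exactSmoothForms h (wedge_mem_exactSmoothForms_of_left hα β.2))

theorem _root_.HostAPI.Carriers.Geometry.Kaehler.deRhamCohomology.cup_mk_mk (h : k + l = m) (α : HostAPI.Carriers.Geometry.Kaehler.closedSmoothForms I M A k) (β : HostAPI.Carriers.Geometry.Kaehler.closedSmoothForms I M A l) :
    cup h (mk α) (mk β) = mk (closedWedge h α β) :=
  rfl

theorem _root_.HostAPI.Carriers.Geometry.Kaehler.deRhamCohomology.cup_gradedComm (h : k + l = m) (h' : l + k = m) (a : deRhamCohomology I M A k)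
    (b : deRhamCohomology I M A l) : cup h' b a = ((-1 : ℝ) ^ (k * l)) • cup h a b := by
  obtain ⟨α, rfl⟩ := mk_surjective a
  obtain ⟨β, rfl⟩ := mk_surjective b
  rw [cup_mk_mk, cup_mk_mk, ← map_smul]
  congr 1
  refine Subtype.ext ?_
  simp only [coe_closedWedge, Submodule.coe_smul]
  rw [HostAPI.Carriers.Geometry.Kaehler.MForm.wedge_comm (α : HostAPI.Carriers.Geometry.Kaehler.MForm I M A k) (β : HostAPI.Carriers.Geometry.Kaehler.MForm I M A l), HostAPI.Carriers.Geometry.Kaehler.MForm.castDeg_smul,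
    HostAPI.Carriers.Geometry.Kaehler.MForm.castDeg_castDeg]

theorem _root_.HostAPI.Carriers.Geometry.Kaehler.deRhamCohomology.cup_assoc {kl lm n : ℕ} (hkl : k + l = kl) (hklm : kl + m = n) (hlm : l + m = lm)
    (hklm' : k + lm = n) (a : deRhamCohomology I M A k) (b : deRhamCohomology I M A l)
    (c : deRhamCohomology I M A m) :
    cup hklm (cup hkl a b) c = cup hklm' a (cup hlm b c) := by
  obtain ⟨α, rfl⟩ := mk_surjective a
  obtain ⟨β, rfl⟩ := mk_surjective b
  obtain ⟨γ, rfl⟩ := mk_surjective c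
  simp only [cup_mk_mk]
  congr 1
  refine Subtype.ext ?_
  subst hkl hlm hklm
  simp only [coe_closedWedge, HostAPI.Carriers.Geometry.Kaehler.MForm.castDeg_rfl]
  rw [HostAPI.Carriers.Geometry.Kaehler.MForm.wedge_assoc]

variable [IsManifold I ∞ M] [IsManifold I' ∞ N]

theorem _root_.HostAPI.Carriers.Geometry.Kaehler.deRhamCohomology.cup_map [WedgeFacts I' N A] [PullbackFacts I M I' N A] (h : k + l = m) {f : M → N}
    (hf : ContMDiff I I' ∞ f) (a : deRhamCohomology I' N A k) (b : deRhamCohomology I' N A l) :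
    map hf m (cup h a b) = cup h (map hf k a) (map hf l b) := by
  obtain ⟨α, rfl⟩ := mk_surjective a
  obtain ⟨β, rfl⟩ := mk_surjective b
  rw [cup_mk_mk, map_mk, map_mk, map_mk, cup_mk_mk]
  congr 1
  refine Subtype.ext ?_
  simp only [coe_closedWedge, HostAPI.Carriers.Geometry.Kaehler.MForm.pullback_castDeg, HostAPI.Carriers.Geometry.Kaehler.MForm.pullback_wedge]

end Cup

end deRhamCohomology

end HostAPI.Carriers.NumberTheory.Transcendental
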